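import Literature.NumberTheory.Automorphic.ParabolicGL
import Literature.NumberTheory.Automorphic.UnitaryGroupAutomorphicRep
import HarnessLib

/-!
# K2 ∕ E3 «EllipticInputs», 13a road A, helper D₂∕J4 (ii)-alg: the LEVI PART of a unitary block-upper-triangular matrix is unitary;
# `(P_c ⊓ U, M_c ⊓ U, U_c ⊓ U)` is a parabolic triple of `U = U(σ, J)` for an anti-block form `J`

Cell `hodgecm-mathlib` (Track B «K2-LIT»), item h413 = `stmt-HodgeConjecture-24833`; author K2E3-p10 (g2); count-neutral helper for the 13a
line (socket U12-g, road A; K2E3-p13 MEMO `MEMO-13a-admissibility-generalN` §5 «D: `standardParabolicTriple σ J S : ParabolicTriple ↥U`» and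
K2-defs1 (g2) 2026-09-03T23:11Z (2): «`ParabolicTriple` carries the PROOF fields `le_normalizer` and `isComplement'` — the Levi decomposition
`P_S ∩ U = (M_S ∩ U) ⋉ (N_S ∩ U)` INSIDE `U` … the block-diagonal part of a unitary block-upper-triangular matrix is unitary for an
anti-block-diagonal Witt form»).  PROOF lane: theorems only (no `def`, no `instance`, no `sorry`), over ★ `ParabolicGL`
(`standardParabolicGL`, `leviProjection`, `leviEmbeddingP`, `standardLeviGL`, `unipotentRadicalGL`, `parabolicTripleGL`) and ★ `unitaryGroupOfForm`.

Setting: a commutative ring `R` with `σ : R →+* R`, a block labelling `c : n → α` (`α` linearly ordered), and a form `J ∈ Mₙ(R)` that is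
**anti-block** for an order-reversing injection `τ : α → α`: `J k l ≠ 0 → c l = τ (c k)` (the Witt form `W♭(r, H_an)` of ★
`K2E3HermitianWittBasis` §4 with its block labelling `(e-blocks ∣ an ∣ mirrored f-blocks)` and `τ` = reversal is the case in point;
so is Mok's `Φ_N` with any palindromic block labelling).

* §1 `transpose_map_mul_mul_apply` (the double-sum formula for `(ᵗσX · J · Y)_{ij}`) and **`blockDiag_formCongr_eq_of_antiBlock`**: if `g` is
  block-upper-triangular (`Matrix.BlockTriangular g c`) and `ᵗ(σg) J g = J`, then its BLOCK-DIAGONAL PART `d(g)_{ij} = [c i = c j] g_{ij}`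
  satisfies `ᵗ(σ d(g)) J d(g) = J` (for `c j = τ(c i)` only the diagonal blocks contribute to `(ᵗσg J g)_{ij}`; otherwise both sides vanish).
* §2 `coe_leviPart_apply`: the ★ Levi part `leviEmbeddingP R c (leviProjection R c p)` of `p ∈ P_c` IS `d(p)` entrywise;
  **`leviPart_mem_unitaryGroupOfForm`**: for `p ∈ P_c ∩ U(σ, J)` the Levi part lies in `U(σ, J)`.
* §3 the two proof fields of the unitary standard parabolic triple, for the pulled-back subgroups of `↥U(σ, J)`
  (`P := P_c.comap U.subtype`, `M := M_c.comap U.subtype`, `N := U_c.comap U.subtype`): **`le_normalizer_parabolic_unitary`** and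
  **`isComplement'_levi_unipotent_unitary`** (`P ∩ U = (M ∩ U) ⋉ (N ∩ U)`).

References: I. N. Bernstein, A. V. Zelevinsky, *Induced representations of reductive p-adic groups I*, Ann. Sci. ÉNS 10 (1977), §2.1
(standard parabolics of `GL_n`); A. Borel, *Linear Algebraic Groups* (1991), §23.7 (parabolics of unitary groups as stabilisers of
isotropic flags); C. Mœglin, M.-F. Vignéras, J.-L. Waldspurger, LNM 1291 (1987), Chap. 1 I.
-/

set_option autoImplicit false
set_option linter.dupNamespace false

namespace Summit.HodgeConjecture.HodgeConjecture.Cruxes.H413.K2E3UnitaryParabolicLeviPart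

open Literature.NumberTheory.Automorphic
open scoped Matrix MatrixGroups

variable {R : Type*} [CommRing R] (σ : R →+* R) {n : Type*} [Fintype n] [DecidableEq n]
  {α : Type*} [LinearOrder α] (c : n → α)

/-! ## §1 The block-diagonal part of a unitary block-triangular matrix -/

omit [DecidableEq n] [LinearOrder α] in
/-- `(ᵗ(σX) · J · Y)_{ij} = Σ_k Σ_l σ(X_{ki}) J_{kl} Y_{lj}`. [folklore] -/
theorem transpose_map_mul_mul_apply (X J Y : Matrix n n R) (i j : n) :
    ((X.map σ)ᵀ * J * Y) i j = ∑ k, ∑ l, σ (X k i) * J k l * Y l j := by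
  simp only [Matrix.mul_apply, Matrix.transpose_apply, Matrix.map_apply, Finset.sum_mul]
  rw [Finset.sum_comm]

omit [Fintype n] [DecidableEq n] in
/-- Support of the terms of `(ᵗσg J g)_{ij}` for `g` block-triangular and `J` anti-block: a non-zero term `σ(g_{ki}) J_{kl} g_{lj}` has
`c k ≤ c i`, `c l = τ (c k)`, `c l ≤ c j`. [folklore] -/
theorem term_support (τ : α → α) (J : Matrix n n R) (hJ : ∀ k l, J k l ≠ 0 → c l = τ (c k))
    (g : Matrix n n R) (hg : g.BlockTriangular c) {i j k l : n} (h : σ (g k i) * J k l * g l j ≠ 0) :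
    c k ≤ c i ∧ c l = τ (c k) ∧ c l ≤ c j := by
  have h1 : g k i ≠ 0 := fun h0 => h (by rw [h0, map_zero, zero_mul, zero_mul])
  have h2 : J k l ≠ 0 := fun h0 => h (by rw [h0, mul_zero, zero_mul])
  have h3 : g l j ≠ 0 := fun h0 => h (by rw [h0, mul_zero])
  refine ⟨not_lt.1 fun hlt => h1 (hg hlt), hJ k l h2, not_lt.1 fun hlt => h3 (hg hlt)⟩

omit [Fintype n] [DecidableEq n] in
/-- In the ANTI-BLOCK position `c j = τ (c i)` only the diagonal blocks contribute: a non-zero term of `(ᵗσg J g)_{ij}` has `c k = c i` and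
`c l = c j` (`τ` order-reversing and injective). [folklore] -/
theorem term_support_diag (τ : α → α) (hτ : ∀ a b, a ≤ b → τ b ≤ τ a) (hτi : Function.Injective τ)
    (J : Matrix n n R) (hJ : ∀ k l, J k l ≠ 0 → c l = τ (c k))
    (g : Matrix n n R) (hg : g.BlockTriangular c) {i j k l : n} (hij : c j = τ (c i))
    (h : σ (g k i) * J k l * g l j ≠ 0) : c k = c i ∧ c l = c j := by
  obtain ⟨hki, hkl, hlj⟩ := term_support σ c τ J hJ g hg h
  have h1 : τ (c i) ≤ τ (c k) := hτ _ _ hki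
  have hlj' : c l = c j := le_antisymm hlj (by rw [hij, hkl]; exact h1)
  refine ⟨hτi ?_, hlj'⟩
  rw [← hkl, hlj', hij]

omit [DecidableEq n] in
/-- **The block-diagonal part of a unitary block-upper-triangular matrix is unitary** (anti-block form): with
`d(g)_{ij} = [c i = c j] · g_{ij}`, `ᵗ(σ d(g)) J d(g) = J`. [cite: BernsteinZelevinsky1977, §2.1] -/
theorem blockDiag_formCongr_eq_of_antiBlock (τ : α → α) (hτ : ∀ a b, a ≤ b → τ b ≤ τ a) (hτi : Function.Injective τ)
    (J : Matrix n n R) (hJ : ∀ k l, J k l ≠ 0 → c l = τ (c k))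
    (g : Matrix n n R) (hg : g.BlockTriangular c) (hgU : (g.map σ)ᵀ * J * g = J) :
    ((Matrix.of fun i j => if c i = c j then g i j else 0).map σ)ᵀ * J *
      (Matrix.of fun i j => if c i = c j then g i j else 0) = J := by
  ext i j
  rw [transpose_map_mul_mul_apply]
  by_cases hij : c j = τ (c i)
  · -- anti-block position: compare with `(ᵗσg J g)_{ij} = J_{ij}` term by term
    conv_rhs => rw [← hgU, transpose_map_mul_mul_apply]
    refine Finset.sum_congr rfl fun k _ => Finset.sum_congr rfl fun l _ => ?_
    simp only [Matrix.of_apply]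
    by_cases hk : c k = c i
    · by_cases hl : c l = c j
      · rw [if_pos hk, if_pos hl]
      · rw [if_neg hl, mul_zero]
        by_contra hne
        exact hl (term_support_diag σ c τ hτ hτi J hJ g hg hij (Ne.symm hne)).2
    · rw [if_neg hk, map_zero, zero_mul, zero_mul]
      by_contra hne
      exact hk (term_support_diag σ c τ hτ hτi J hJ g hg hij (Ne.symm hne)).1
  · -- off the anti-block positions both sides vanish
    have hJij : J i j = 0 := by
      by_contra h0
      exact hij (hJ i j h0)
    rw [hJij]
    refine Finset.sum_eq_zero fun k _ => Finset.sum_eq_zero fun l _ => ?_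
    simp only [Matrix.of_apply]
    by_cases hk : c k = c i
    · by_cases hl : c l = c j
      · rw [if_pos hk, if_pos hl]
        by_cases hJkl : J k l = 0
        · rw [hJkl, mul_zero, zero_mul]
        · exact absurd (by rw [← hl, hJ k l hJkl, hk]) hij
      · rw [if_neg hl, mul_zero]
    · rw [if_neg hk, map_zero, zero_mul, zero_mul]

/-! ## §2 The Levi part of `p ∈ P_c ∩ U(σ, J)` is unitary -/

variable [Fintype α]

/-- Entries of the Levi part: `(ℓ(p))_{ij} = [c i = c j] · p_{ij}` (★ `blockDiagonalGL_apply_coe`, Mathlib `blockDiagonal'_apply_eq∕_ne`).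
[cite: BernsteinZelevinsky1977, §2.1] -/
theorem coe_leviPart_apply (p : standardParabolicGL R c) (i j : n) :
    ((leviEmbeddingP R c (leviProjection R c p) : GL n R) : Matrix n n R) i j =
      if c i = c j then ((p : GL n R) : Matrix n n R) i j else 0 := by
  rw [coe_leviEmbeddingP, blockDiagonalGL_apply_coe]
  by_cases h : c i = c j
  · rw [if_pos h]
    have hj : c j = c i := h.symm
    have : (⟨c j, ⟨j, rfl⟩⟩ : Σ a, {k // c k = a}) = ⟨c i, ⟨j, hj⟩⟩ := Sigma.subtype_ext hj rfl
    rw [this, Matrix.blockDiagonal'_apply_eq]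
    rfl
  · rw [if_neg h, Matrix.blockDiagonal'_apply_ne _ _ _ h]

/-- **The Levi part of `p ∈ P_c ∩ U(σ, J)` lies in `U(σ, J)`** for an anti-block form `J` (`J k l ≠ 0 → c l = τ (c k)`, `τ` order-reversing
and injective). [cite: BernsteinZelevinsky1977, §2.1] -/
theorem leviPart_mem_unitaryGroupOfForm (τ : α → α) (hτ : ∀ a b, a ≤ b → τ b ≤ τ a)
    (hτi : Function.Injective τ) (J : Matrix n n R) (hJ : ∀ k l, J k l ≠ 0 → c l = τ (c k))
    (p : standardParabolicGL R c) (hp : (p : GL n R) ∈ unitaryGroupOfForm σ J) :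
    (leviEmbeddingP R c (leviProjection R c p) : GL n R) ∈ unitaryGroupOfForm σ J := by
  rw [mem_unitaryGroupOfForm_iff] at hp ⊢
  have hmat : ((leviEmbeddingP R c (leviProjection R c p) : GL n R) : Matrix n n R) =
      Matrix.of fun i j => if c i = c j then ((p : GL n R) : Matrix n n R) i j else 0 :=
    Matrix.ext fun i j => by rw [coe_leviPart_apply, Matrix.of_apply]
  rw [hmat]
  exact blockDiag_formCongr_eq_of_antiBlock σ c τ hτ hτi J hJ _ (blockTriangular_of_mem p) hp

/-! ## §3 The proof fields of the unitary standard parabolic triple `(P_c ∩ U, M_c ∩ U, U_c ∩ U)` -/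

/-- **`P_c ∩ U` normalises `U_c ∩ U`** (inside `↥U(σ, J)`; pulled back from ★ `parabolicTripleGL`). [cite: BernsteinZelevinsky1977, §2.1] -/
theorem le_normalizer_parabolic_unitary (J : Matrix n n R) :
    (standardParabolicGL R c).comap (unitaryGroupOfForm σ J).subtype ≤
      Subgroup.normalizer (((unipotentRadicalGL R c).comap (unitaryGroupOfForm σ J).subtype :
        Subgroup ↥(unitaryGroupOfForm σ J)) : Set ↥(unitaryGroupOfForm σ J)) := by
  intro p hp
  rw [Subgroup.mem_comap, Subgroup.coe_subtype] at hp
  have hP := (parabolicTripleGL R c).le_normalizer hp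
  rw [Subgroup.mem_normalizer_iff] at hP ⊢
  intro x
  simp only [Subgroup.mem_comap, Subgroup.coe_subtype, Subgroup.coe_mul, Subgroup.coe_inv]
  exact hP (x : GL n R)

/-- **`P_c ∩ U = (M_c ∩ U) ⋉ (U_c ∩ U)`** for an anti-block form: the Levi subgroup and the unipotent radical, intersected with
`U = U(σ, J)`, are complementary in `P_c ∩ U` — disjointness from ★ `parabolicTripleGL`, and every `p ∈ P_c ∩ U` is
`ℓ(p) · (ℓ(p)⁻¹ p)` with `ℓ(p) ∈ M_c ∩ U` (§2) and `ℓ(p)⁻¹ p ∈ U_c`. [cite: BernsteinZelevinsky1977, §2.1] -/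
theorem isComplement'_levi_unipotent_unitary (τ : α → α) (hτ : ∀ a b, a ≤ b → τ b ≤ τ a)
    (hτi : Function.Injective τ) (J : Matrix n n R) (hJ : ∀ k l, J k l ≠ 0 → c l = τ (c k)) :
    (((standardLeviGL R c).comap (unitaryGroupOfForm σ J).subtype).subgroupOf
        ((standardParabolicGL R c).comap (unitaryGroupOfForm σ J).subtype)).IsComplement'
      (((unipotentRadicalGL R c).comap (unitaryGroupOfForm σ J).subtype).subgroupOf
        ((standardParabolicGL R c).comap (unitaryGroupOfForm σ J).subtype)) := by
  set U := unitaryGroupOfForm σ J with hUdef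
  refine Subgroup.isComplement'_of_disjoint_and_mul_eq_univ ?_ ?_
  · -- disjointness, from `M_c ⊓ U_c = ⊥` inside `P_c`
    rw [Subgroup.disjoint_def]
    intro x hxM hxN
    rw [Subgroup.mem_subgroupOf, Subgroup.mem_comap, Subgroup.coe_subtype] at hxM hxN
    have hxP : ((x : ↥U) : GL n R) ∈ standardParabolicGL R c := by
      have := x.2; rwa [Subgroup.mem_comap, Subgroup.coe_subtype] at this
    have hdis := (parabolicTripleGL R c).isComplement'.disjoint
    rw [Subgroup.disjoint_def] at hdis
    have h1 : (⟨((x : ↥U) : GL n R), hxP⟩ : ↥(standardParabolicGL R c)) = 1 :=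
      hdis (Subgroup.mem_subgroupOf.2 hxM) (Subgroup.mem_subgroupOf.2 hxN)
    have h2 : ((x : ↥U) : GL n R) = 1 := congrArg Subtype.val h1
    exact Subtype.ext (Subtype.ext h2)
  · refine Set.eq_univ_of_forall fun p => ?_
    have hpP : ((p : ↥U) : GL n R) ∈ standardParabolicGL R c := by
      have := p.2; rwa [Subgroup.mem_comap, Subgroup.coe_subtype] at this
    set q : ↥(standardParabolicGL R c) := ⟨((p : ↥U) : GL n R), hpP⟩ with hqdef
    -- the Levi part, as an element of `U`, of `P_c ∩ U`, of `M_c ∩ U`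
    have hℓU : (leviEmbeddingP R c (leviProjection R c q) : GL n R) ∈ U :=
      leviPart_mem_unitaryGroupOfForm σ c τ hτ hτi J hJ q (p : ↥U).2
    have hℓP : (leviEmbeddingP R c (leviProjection R c q) : GL n R) ∈ standardParabolicGL R c :=
      (leviEmbeddingP R c (leviProjection R c q)).2
    have hℓM : (leviEmbeddingP R c (leviProjection R c q) : GL n R) ∈ standardLeviGL R c := ⟨_, rfl⟩
    let ℓU : ↥U := ⟨_, hℓU⟩
    have hℓUP : ℓU ∈ (standardParabolicGL R c).comap U.subtype := by
      rw [Subgroup.mem_comap, Subgroup.coe_subtype]; exact hℓP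
    let m : ↥((standardParabolicGL R c).comap U.subtype) := ⟨ℓU, hℓUP⟩
    refine Set.mem_mul.2 ⟨m, ?_, m⁻¹ * p, ?_, mul_inv_cancel_left _ _⟩
    · rw [SetLike.mem_coe, Subgroup.mem_subgroupOf, Subgroup.mem_comap, Subgroup.coe_subtype]
      exact hℓM
    · rw [SetLike.mem_coe, Subgroup.mem_subgroupOf, Subgroup.mem_comap, Subgroup.coe_subtype]
      -- `ℓ(q)⁻¹ q ∈ U_c`: kernel of the Levi projection, by the section identity
      have hker : (leviEmbeddingP R c (leviProjection R c q))⁻¹ * q ∈ unipotentRadicalP R c := by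
        rw [MonoidHom.mem_ker, map_mul, map_inv, leviProjection_leviEmbeddingP_apply, inv_mul_cancel]
      have hN : (((leviEmbeddingP R c (leviProjection R c q))⁻¹ * q : ↥(standardParabolicGL R c)) : GL n R) ∈
          unipotentRadicalGL R c := by
        rw [← unipotentRadicalGL_subgroupOf] at hker
        exact Subgroup.mem_subgroupOf.1 hker
      exact hN

end Summit.HodgeConjecture.HodgeConjecture.Cruxes.H413.K2E3UnitaryParabolicLeviPart
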